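import Summits.CriticalPhenomena.SAWScalingLimit.Theses.SAWRenewalTightness
import Summits.CriticalPhenomena.SAWScalingLimit.Theorems.TubeLowerBound.Negative.TubeLowerBoundLoadBearing
import Summits.CriticalPhenomena.SAWScalingLimit.Theorems.SAWRenewalTightnessTubeLowerBoundProfilePotentialDefs
import Summits.CriticalPhenomena.SAWScalingLimit.Theorems.SAWRenewalTightnessTubeLowerBoundOfQuadrantProfile
import Summits.CriticalPhenomena.SAWScalingLimit.Theorems.SAWRenewalTightnessTubeLowerBoundOfCountCeiling

/-!
# STRATEGY-CENSUS signatures — crux `TubeLowerBound` (stmt-CriticalPhenomena-4730)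

Typed forms of the transfer / strengthen / decomposition statements discussed in
`Cruxes/TubeLowerBound/STRATEGY-CENSUS.md` (planner-cstrat-…-p1-0, 2026-08-17).  Props only (no proofs,
no sorries); the landed doors are re-checked by name at the end.
-/

noncomputable section

namespace Summit.CriticalPhenomena.SAWScalingLimit.Cruxes.TubeLowerBound.StrategyCensus

open Literature.Probability.LatticeModels Literature.Probability.RandomPlanarGeometry
open Literature.Probability.RandomPlanarGeometry.SAW
open Summit.CriticalPhenomena.SAWScalingLimit.Theses.SAWRenewalTightness (TubeLowerBound)
open Summit.CriticalPhenomena.SAWScalingLimit.Theorems.TubeLowerBound.Negative (tubeMass)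
open Summit.CriticalPhenomena.SAWScalingLimit.Theorems.TubeLowerBound.ProfilePotential
  (SpanRenewalFloor QuadrantDivergence QuadrantProfileBound CountProfileBound)
open scoped BigOperators

/-- Partial sums of the `x_c`-mass of bridges of span `L` (vertex bridges `Zd.bridges`, span = first
coordinate of the endpoint), the summand of the tree's `StripMassConservation` / `SpanRenewalFloor`. -/
def uSpanPartial (L : ℤ) (N : ℕ) : ℝ :=
  ∑ n ∈ Finset.range (N + 1), ∑ _ω ∈ (Zd.bridges 2 n).filter (fun ω => ω n 0 = L), criticalFugacity ^ n

/-- The full span-renewal mass `u_L = sup_N` of the partial sums (`≤ 1` by `stripMassConservation_proof`). -/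
def uSpan (L : ℤ) : ℝ := ⨆ N : ℕ, uSpanPartial L N

/-- **TRANSFER (hexagonal lattice, DCS12 §3).** On the hexagonal lattice the strip identity
`c_α A_T + B_T = 1` turns the soft inequality `A_{T+1} − A_T ≤ x_c B_{T+1}²` (valid on `ℤ²` too) into
`B_T − B_{T+1} ≤ c_α x_c B_{T+1}²`, whence `B_T ≥ c/T`.  The `ℤ²` SUBSTITUTE that the transferring argument
needs is exactly this Riccati-type decrement bound for the span-renewal masses; nothing on `ℤ²` supplies it
(no observable; `u_{L+1} ≥ x_c u_L` is all that appending a step gives). OPEN. -/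
def BridgeDecrementBound : Prop :=
  ∃ C : ℝ, 0 ≤ C ∧ ∀ L : ℤ, 1 ≤ L → uSpan L - uSpan (L + 1) ≤ C * uSpan (L + 1) ^ 2

/-- The elementary half of the DCS12 argument (provable now, real analysis only): a positive sequence with
Riccati-bounded decrements has a `c/L` floor.  With `BridgeDecrementBound` it gives the span-renewal floor
`u_L ≥ c/L`, i.e. the milestone `SpanRenewalFloor` with `C = 1` — but NOT the crux (one-sidedness /
transversal control of bridges is a second boundary-type input, S1-VERDICT-c1 §3 (T1)). -/
def RiccatiLemma : Prop :=
  ∀ (b : ℕ → ℝ) (C : ℝ), 0 ≤ C → (∀ L, 0 < b L) →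
    (∀ L, 1 ≤ L → b L - b (L + 1) ≤ C * b (L + 1) ^ 2) →
      ∃ c : ℝ, 0 < c ∧ ∀ L : ℕ, 1 ≤ L → c / (L : ℝ) ≤ b L

/-- **STRENGTHEN S⁺₁ (measure switch to the uniform law `P_n`).** A fixed-length counting floor: for some
length `n` the FRACTION of `n`-step SAWs from `u` that end at `v` inside the tube is polynomially large.
Implies the crux through `μⁿ ≤ c_n` (`Zd.pow_connectiveConstant_le_count`: `c_n x_cⁿ ≥ 1`), with no
ceiling needed; but no tool gives confinement floors under `P_n` (DC–H, DGHM, Hammond prove CEILINGS on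
rare events), see the census §Strengthen. -/
def UniformMeasureTubeFloor : Prop :=
  ∃ C c : ℝ, 0 < c ∧ ∀ (u v : Site 2) (ℓ : ℝ), 1 ≤ ℓ →
    dist (Site.toComplex u) (Site.toComplex v) ≤ ℓ →
      ∃ n : ℕ, c * ℓ ^ (-C) * (Zd.count 2 n : ℝ) ≤
        (((Zd.sawFun 2 n (v - u)).filter (fun ω => ∀ i ≤ n,
          Metric.infDist (Site.toComplex (u + ω i))
            (segment ℝ (Site.toComplex u) (Site.toComplex v)) ≤ ℓ / 10 + 2)).card : ℝ)

/-- The cheapest instance of a `P_n`-floor for a PINCHED class: `P_n(ω is a bridge) ≥ c n^{-C}`.  Since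
`b_n ≤ μⁿ` (`Zd.bridgeCount_le_pow`), it implies `c_n ≤ c⁻¹ n^C μⁿ`, i.e. `CountCeiling` (polynomial
Hammersley–Welsh) — so in the `P_n` language floors for pinched classes are (C)-hard. -/
def UniformMeasureBridgeFloor : Prop :=
  ∃ C c : ℝ, 0 < c ∧ ∀ n : ℕ, 1 ≤ n → c * (n : ℝ) ^ (-C) * (Zd.count 2 n : ℝ) ≤ ((Zd.bridges 2 n).card : ℝ)

/-- (C) verbatim: the hypothesis of the landed door `LassoRepair.TubeLowerBound_of_countCeiling` (p113604). -/
def CountCeiling : Prop :=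
  ∃ C : ℝ, 0 ≤ C ∧ ∀ n : ℕ, (Zd.count 2 n : ℝ) * criticalFugacity ^ n ≤ ((n : ℝ) + 1) ^ C

/-- **STRENGTHEN S⁺₂ (scale-invariant endpoint Harnack / quasi-multiplicativity).** Moving the endpoint by
one lattice step changes the tube mass by at most a polynomial factor.  With the landed `dominoFloor_holds`
and `quarterFlux` it would propagate the Simon–Lieb side floors pointwise and across aspect ratios; it is the
SAW analogue of percolation's RSW-based regularity and is STRONGER than the crux with no inductive handle
(the inductive step is the gluing itself). OPEN, not in print. -/
def TubeHarnack : Prop :=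
  ∃ C : ℝ, 0 ≤ C ∧ ∀ (u v v' : Site 2) (ℓ : ℝ), 1 ≤ ℓ →
    dist (Site.toComplex u) (Site.toComplex v) ≤ ℓ →
    dist (Site.toComplex u) (Site.toComplex v') ≤ ℓ →
    dist (Site.toComplex v) (Site.toComplex v') ≤ 1 →
      (⨆ N : ℕ, tubeMass criticalFugacity u v' (ℓ / 10 + 2) N) ≤
        C * ℓ ^ C * ⨆ N : ℕ, tubeMass criticalFugacity u v (ℓ / 10 + 3) N

/-- **DECOMPOSITION D2, first piece: the axis case of the crux** (`v − u = (L, 0)`, `ℓ = L`): a pointwise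
floor for the critical two-point function of a `1 : 5` strip crossed LENGTHWISE between two interior points
("RSW for SAW", S1-VERDICT-c1 §3 (T3)/(T4); fat version = `dominoFloor_holds`, landed). OPEN. -/
def AxisThinTubeFloor : Prop :=
  ∃ C c : ℝ, 0 < c ∧ ∀ L : ℕ, 1 ≤ L → ∃ N : ℕ,
    c * (L : ℝ) ^ (-C) ≤ tubeMass criticalFugacity 0 ![(L : ℤ), 0] ((L : ℝ) / 10 + 2) N

/-- **DECOMPOSITION D2, second piece: a right-angle TURN gadget** — an L-shaped two-leg tube floor with the
junction at a BULK point `w`.  `AxisThinTubeFloor ∧ TurnFloor → TubeLowerBound` would still need a gluing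
theorem at the bulk junctions `u`, `v` of consecutive gadgets, which is the wall itself (2-arm floor at a
bulk point); recorded to show where the best "geometric" split breaks. -/
def TurnFloor : Prop :=
  ∃ C c : ℝ, 0 < c ∧ ∀ L : ℕ, 1 ≤ L → ∃ N : ℕ,
    c * (L : ℝ) ^ (-C) ≤ ∑ n ∈ Finset.range (N + 1),
      ∑ _ω ∈ (Zd.sawFun 2 n ![(L : ℤ), (L : ℤ)]).filter (fun ω => ∀ i ≤ n,
        min (Metric.infDist (Site.toComplex (ω i)) (segment ℝ (0 : ℂ) (L : ℂ)))
            (Metric.infDist (Site.toComplex (ω i)) (segment ℝ (L : ℂ) (⟨L, L⟩ : ℂ))) ≤ (L : ℝ) / 10 + 2),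
      criticalFugacity ^ n

/-! ### Landed doors, re-checked by name (the decomposition inventory of the census) -/

example : QuadrantDivergence → QuadrantProfileBound → TubeLowerBound :=
  Summit.CriticalPhenomena.SAWScalingLimit.Theorems.TubeLowerBound.ProfilePotential.TubeLowerBound_of_quadrantProfile

example : QuadrantDivergence → CountProfileBound → TubeLowerBound :=
  Summit.CriticalPhenomena.SAWScalingLimit.Theorems.TubeLowerBound.ProfilePotential.TubeLowerBound_of_countProfile

example (h : Zd.EnumerationExponentConjecture2D) : TubeLowerBound :=
  Summit.CriticalPhenomena.SAWScalingLimit.Theorems.TubeLowerBound.LassoRepair.TubeLowerBound_of_enumerationExponentConjecture2D h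

example : CountCeiling → TubeLowerBound := fun h =>
  Summit.CriticalPhenomena.SAWScalingLimit.Theorems.TubeLowerBound.LassoRepair.TubeLowerBound_of_countCeiling h

end Summit.CriticalPhenomena.SAWScalingLimit.Cruxes.TubeLowerBound.StrategyCensus

end
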